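import Mathlib
import Literature.NumberTheory.Automorphic.ToricPseudoEisensteinSeries
import HarnessLib

/-!
# Toric pseudo-Eisenstein series: the unwinding adjunction and the annihilation consequence

Topic `NumberTheory/Automorphic`; namespace `Literature.NumberTheory.Automorphic.PseudoEisenstein`
(continued from `ToricPseudoEisensteinSeries`, whose model — `G ⊇ Γ`, `jT : T →* G`, weight `β`,
character `χ`, `Ξ_β`, `E^χ_f = Eis`, `toricPeriod` — is in force).

The defining property of pseudo-Eisenstein series is the *adjunction* with the period ("constant
term") map along the subgroup: `∫_{Γ\G} Ψ_φ · f = ∫_{Γ_H H\G} φ · c_H f`, proved by unwinding the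
`Γ_H\Γ`-sum against `Γ\G` and winding up the `H`-integral [Garrett2018, §1.8 (display before
Claim 1.8.1) and Cor. 1.8.2]; [MoeglinWaldspurger1995, II.1.11]. Its corollary
[Garrett2018, Cor. 1.8.2] is that the orthogonal complement of all pseudo-Eisenstein series is
the space of forms whose `H`-periods vanish (cusp forms, for `H = N`).

This file proves the toric, `χ`-twisted instance in the model of `ToricPseudoEisensteinSeries`:

* `unfolding` : for `K : G → ℂ` continuous and left-`Γ`-invariant and `f ∈ C_c(G)`,
  `∫_{𝓕} E^χ_f(y) K(y) dμ = ∫_G f(h) (∫_T β(t) χ(t) K(jT(t) h) dν) dμ(h)`, where `𝓕` is a measurable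
  fundamental domain for `Γ` in `G` (so `∫_𝓕` is `∫_{Γ\G}`) and `μ` is LEFT-invariant and finite on
  compacts (no unimodularity is used; nothing about `ν` beyond finiteness on compacts);
  corollaries `unfolding_theta` (against a kernel `θ_x(y)` with an equivariance
  `θ_x(jT(t) h) = θ_{ω(h)x}(jT(t))`) and `unfolding_inner` (against `conj ∘ v`:
  `⟨E^χ_f, v⟩ = ∫_G f(h) conj(∫_T β conj χ · v(jT(·) h) dν) dμ`);
* `closureSpan_invariant` : a continuous linear operator mapping a set `S` into itself preserves the
  closure of its span (with `Eis_rTrans`: the closed span of the `E^χ_f` is right-translation stable);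
* `eq_zero_of_forall_integral_mul_eq_zero` : the fundamental lemma of the calculus of variations,
  continuous form, for any measure charging open sets;
* `continuous_toricPeriod_conj`, `toricPeriod_transl_eq_zero_of_orthogonal` : the annihilation
  consequence — if a continuous left-`Γ`-invariant `v` is orthogonal to every `E^χ_f`, `f ∈ C_c(G)`,
  then the toric period `∫_T β conj χ · v(jT(·) h) dν` of EVERY right translate of `v` vanishes
  (the toric analogue of [Garrett2018, Cor. 1.8.2]).

Mathlib inputs: Fubini for compactly supported continuous integrands
(`MeasureTheory.integral_integral_swap_of_hasCompactSupport`), unfolding over a fundamental domain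
(`MeasureTheory.IsFundamentalDomain.integral_eq_tsum''`), left invariance
(`MeasureTheory.integral_mul_left_eq_self`), Urysohn bumps (`exists_tsupport_one_of_isOpen_isClosed`).

Provenance: HodgeCM PerL cell `pub-hodgecm`, package file `HodgeCM/PerL34/PseudoEisenstein.lean`
(seat pv15, gate run 20), sections `Unfolding`, `SpanClosure`, `FundamentalLemma`, `Consequence`,
ported to the tree under the LEAN-IN-TREE rule by seat pv15-g7 (names `HodgeCM.PerL34.N23a.X` ↦
`Literature.NumberTheory.Automorphic.PseudoEisenstein.X`, statements verbatim).

## References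

* P. Garrett, *Modern Analysis of Automorphic Forms by Example*, vol. 1 (2018), §1.8 (the
  unwinding/winding-up adjunction; Cor. 1.8.2) [Garrett2018].
* C. Moeglin, J.-L. Waldspurger, *Spectral Decomposition and Eisenstein Series* (1995), II.1.10–II.1.12
  [MoeglinWaldspurger1995].
* R. Godement, *The spectral decomposition of cusp-forms*, Proc. Sympos. Pure Math. IX (1966), §3
  [Godement1966].
-/

noncomputable section

open _root_.MeasureTheory Set Filter Function
open scoped Pointwise ENNReal

namespace Literature.NumberTheory.Automorphic

namespace PseudoEisenstein

/-! ## The unfolding identity -/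

section Unfolding

variable {G : Type*} [Group G] [TopologicalSpace G] [IsTopologicalGroup G] [T2Space G]
  [MeasurableSpace G] [BorelSpace G]
  {T : Type*} [Group T] [TopologicalSpace T] [T2Space T] [MeasurableSpace T] [OpensMeasurableSpace T]

/-- **Unfolding** (the unwinding/winding-up adjunction). For `K : G → ℂ` continuous and
left-`Γ`-invariant,
`∫_{Γ\G} E^χ_f(y) K(y) dy = ∫_G f(h) (∫_{Γ_T\T} K(t h) χ(t) dt) dh`,
with `Γ\G` realised by the fundamental domain `𝓕` and `∫_{Γ_T\T} (·) χ dt` by `∫_T β χ (·) dν`.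
Only LEFT invariance of `μ` is used (no unimodularity), and nothing about `ν` beyond finiteness on
compact sets. [cite: Garrett2018, §1.8] -/
theorem unfolding
    (μ : Measure G) [μ.IsMulLeftInvariant] [IsFiniteMeasureOnCompacts μ]
    (ν : Measure T) [IsFiniteMeasureOnCompacts ν]
    (jT : T →* G) (hjT : Continuous jT)
    (β : T → ℝ) (hβ : Continuous β) (hβs : HasCompactSupport β)
    (χ : T → ℂ) (hχ : Continuous χ)
    (Γ : Subgroup G) [Countable Γ] (𝓕 : Set G) (h𝓕 : IsFundamentalDomain Γ 𝓕 μ)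
    (f : G → ℂ) (hf : Continuous f) (hfs : HasCompactSupport f)
    (K : G → ℂ) (hK : Continuous K) (hKinv : ∀ (γ : Γ) (y : G), K ((γ : G) * y) = K y) :
    ∫ y in 𝓕, Eis ν jT β χ Γ f y * K y ∂μ = ∫ h, f h * toricPeriod ν jT β χ K h ∂μ := by
  -- abbreviations
  have hXc : Continuous (Xiβ ν jT β χ f) := continuous_Xiβ ν jT hjT β hβ hβs χ hχ f hf
  have hXs : HasCompactSupport (Xiβ ν jT β χ f) := hasCompactSupport_Xiβ ν jT hjT β hβs χ f hfs
  have hint : Integrable (fun x => Xiβ ν jT β χ f x * K x) μ :=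
    (hXc.mul hK).integrable_of_hasCompactSupport hXs.mul_right
  have hwt : Continuous (wt β χ) := continuous_wt hβ hχ
  -- (1) unfold the `Γ`-sum against the fundamental domain
  have step1 : ∫ y in 𝓕, Eis ν jT β χ Γ f y * K y ∂μ
      = ∫ y in 𝓕, ∑' γ : Γ, Xiβ ν jT β χ f ((γ : G) * y) * K y ∂μ := by
    simp only [Eis, tsum_mul_right]
  have hmeas : ∀ γ : Γ, AEStronglyMeasurable (fun y => Xiβ ν jT β χ f ((γ : G) * y) * K y)
      (μ.restrict 𝓕) := by
    intro γ
    exact ((hXc.comp (continuous_const.mul continuous_id)).mul hK).aestronglyMeasurable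
  have hfin : ∑' γ : Γ, ∫⁻ y in 𝓕, ‖Xiβ ν jT β χ f ((γ : G) * y) * K y‖ₑ ∂μ ≠ ∞ := by
    have h := h𝓕.lintegral_eq_tsum'' (fun x => ‖Xiβ ν jT β χ f x * K x‖ₑ)
    simp only [Subgroup.smul_def, smul_eq_mul, hKinv] at h
    rw [← h]
    exact hint.2.ne
  have step2 : ∫ y in 𝓕, ∑' γ : Γ, Xiβ ν jT β χ f ((γ : G) * y) * K y ∂μ
      = ∑' γ : Γ, ∫ y in 𝓕, Xiβ ν jT β χ f ((γ : G) * y) * K y ∂μ :=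
    integral_tsum hmeas hfin
  have step3 : ∑' γ : Γ, ∫ y in 𝓕, Xiβ ν jT β χ f ((γ : G) * y) * K y ∂μ
      = ∫ x, Xiβ ν jT β χ f x * K x ∂μ := by
    have h := h𝓕.integral_eq_tsum'' (fun x => Xiβ ν jT β χ f x * K x) hint
    simp only [Subgroup.smul_def, smul_eq_mul, hKinv] at h
    exact h.symm
  -- (2) write `Ξ_β · K` as an inner `T`-integral and swap (Fubini, compact support)
  have step4 : ∫ x, Xiβ ν jT β χ f x * K x ∂μ
      = ∫ x, ∫ t, wt β χ t * (f ((jT t)⁻¹ * x) * K x) ∂ν ∂μ := by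
    congr 1
    ext x
    rw [Xiβ, ← integral_mul_const]
    congr 1
    ext t
    ring
  have hF₂c : Continuous
      (Function.uncurry fun (t : T) (x : G) => wt β χ t * (f ((jT t)⁻¹ * x) * K x)) := by
    change Continuous fun p : T × G => wt β χ p.1 * (f ((jT p.1)⁻¹ * p.2) * K p.2)
    exact (hwt.comp continuous_fst).mul
      ((hf.comp (((hjT.comp continuous_fst).inv).mul continuous_snd)).mul (hK.comp continuous_snd))
  have hF₂s : HasCompactSupport
      (Function.uncurry fun (t : T) (x : G) => wt β χ t * (f ((jT t)⁻¹ * x) * K x)) := by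
    apply HasCompactSupport.intro
      (hβs.isCompact.prod ((hβs.isCompact.image hjT).mul hfs.isCompact))
    rintro ⟨t, x⟩ hp
    change wt β χ t * (f ((jT t)⁻¹ * x) * K x) = 0
    by_cases ht : t ∈ tsupport β
    · have hx : x ∉ ((jT : T → G) '' tsupport β) * tsupport f := by
        intro hx
        exact hp (Set.mk_mem_prod ht hx)
      have hf0 : f ((jT t)⁻¹ * x) = 0 := by
        apply image_eq_zero_of_notMem_tsupport
        intro hmem
        apply hx
        refine Set.mem_mul.mpr ⟨jT t, Set.mem_image_of_mem _ ht, (jT t)⁻¹ * x, hmem, ?_⟩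
        simp
      simp [hf0]
    · simp [wt_eq_zero_of_notMem β χ ht]
  have step5 : ∫ x, ∫ t, wt β χ t * (f ((jT t)⁻¹ * x) * K x) ∂ν ∂μ
      = ∫ t, ∫ x, wt β χ t * (f ((jT t)⁻¹ * x) * K x) ∂μ ∂ν :=
    (integral_integral_swap_of_hasCompactSupport hF₂c hF₂s).symm
  -- (3) left invariance of `μ`: substitute `x = jT(t) h`
  have step6 : ∀ t : T, ∫ x, wt β χ t * (f ((jT t)⁻¹ * x) * K x) ∂μ
      = ∫ h, f h * (wt β χ t * K (jT t * h)) ∂μ := by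
    intro t
    rw [← integral_mul_left_eq_self (fun x => wt β χ t * (f ((jT t)⁻¹ * x) * K x)) (jT t)]
    congr 1
    ext h
    simp only [inv_mul_cancel_left]
    ring
  have step7 : ∫ t, ∫ x, wt β χ t * (f ((jT t)⁻¹ * x) * K x) ∂μ ∂ν
      = ∫ t, ∫ h, f h * (wt β χ t * K (jT t * h)) ∂μ ∂ν := by
    congr 1
    ext t
    exact step6 t
  -- (4) swap back (Fubini, compact support) and recognise the toric period
  have hF₁c : Continuous
      (Function.uncurry fun (t : T) (h : G) => f h * (wt β χ t * K (jT t * h))) := by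
    change Continuous fun p : T × G => f p.2 * (wt β χ p.1 * K (jT p.1 * p.2))
    exact (hf.comp continuous_snd).mul
      ((hwt.comp continuous_fst).mul (hK.comp ((hjT.comp continuous_fst).mul continuous_snd)))
  have hF₁s : HasCompactSupport
      (Function.uncurry fun (t : T) (h : G) => f h * (wt β χ t * K (jT t * h))) := by
    apply HasCompactSupport.intro (hβs.isCompact.prod hfs.isCompact)
    rintro ⟨t, h⟩ hp
    change f h * (wt β χ t * K (jT t * h)) = 0
    by_cases ht : t ∈ tsupport β
    · have hh : h ∉ tsupport f := fun hh => hp (Set.mk_mem_prod ht hh)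
      simp [image_eq_zero_of_notMem_tsupport hh]
    · simp [wt_eq_zero_of_notMem β χ ht]
  have step8 : ∫ t, ∫ h, f h * (wt β χ t * K (jT t * h)) ∂μ ∂ν
      = ∫ h, ∫ t, f h * (wt β χ t * K (jT t * h)) ∂ν ∂μ :=
    integral_integral_swap_of_hasCompactSupport hF₁c hF₁s
  have step9 : ∫ h, ∫ t, f h * (wt β χ t * K (jT t * h)) ∂ν ∂μ
      = ∫ h, f h * toricPeriod ν jT β χ K h ∂μ := by
    congr 1
    ext h
    rw [toricPeriod, integral_const_mul]
  rw [step1, step2, step3, step4, step5, step7, step8, step9]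

/-- **Unfolding against an equivariant kernel.** `θ x : G → ℂ` is a continuous left-`Γ`-invariant
kernel indexed by `x : X` (e.g. a theta kernel `y ↦ θ_Φ(g, y)` at fixed `g`, `Φ = x` a Schwartz
function), `ω h : X → X` an action of `h ∈ G` on the index set, and the equivariance
`θ_x(jT(t) h) = θ_{ω(h) x}(jT(t))` is the hypothesis `hθω`. Then
`∫_{Γ\G} θ_x · E^χ_f = ∫_G f(h) (∫_T β χ · θ_{ω(h) x} ∘ jT dν) dμ(h)`. [cite: Garrett2018, §1.8] -/
theorem unfolding_theta
    (μ : Measure G) [μ.IsMulLeftInvariant] [IsFiniteMeasureOnCompacts μ]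
    (ν : Measure T) [IsFiniteMeasureOnCompacts ν]
    (jT : T →* G) (hjT : Continuous jT)
    (β : T → ℝ) (hβ : Continuous β) (hβs : HasCompactSupport β)
    (χ : T → ℂ) (hχ : Continuous χ)
    (Γ : Subgroup G) [Countable Γ] (𝓕 : Set G) (h𝓕 : IsFundamentalDomain Γ 𝓕 μ)
    (f : G → ℂ) (hf : Continuous f) (hfs : HasCompactSupport f)
    {X : Type*} (θ : X → G → ℂ) (ω : G → X → X) (x : X)
    (hθ : Continuous (θ x)) (hθinv : ∀ (γ : Γ) (y : G), θ x ((γ : G) * y) = θ x y)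
    (hθω : ∀ (h : G) (t : T), θ x (jT t * h) = θ (ω h x) (jT t)) :
    ∫ y in 𝓕, θ x y * Eis ν jT β χ Γ f y ∂μ
      = ∫ h, f h * (∫ t, wt β χ t * θ (ω h x) (jT t) ∂ν) ∂μ := by
  have h := unfolding μ ν jT hjT β hβ hβs χ hχ Γ 𝓕 h𝓕 f hf hfs (θ x) hθ hθinv
  simp only [toricPeriod, hθω] at h
  simpa only [mul_comm] using h

/-- **Unfolding an inner product.** For a continuous vector `v`, viewed as a left-`Γ`-invariant
continuous function on `G`, with `⟨u, v⟩ = ∫_{Γ\G} u v̄` and the `χ̄`-toric period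
`P_{T,χ̄}(u) := ∫_{Γ_T\T} u(t) χ(t) dt`:
`⟨E^χ_f, v⟩ = ∫_G f(h) conj(P_{T,χ̄}(R(h)v)) dh`, where `(R(h)v)(t) = v(t h)`.
[cite: Garrett2018, §1.8 Cor. 1.8.2] -/
theorem unfolding_inner
    (μ : Measure G) [μ.IsMulLeftInvariant] [IsFiniteMeasureOnCompacts μ]
    (ν : Measure T) [IsFiniteMeasureOnCompacts ν]
    (jT : T →* G) (hjT : Continuous jT)
    (β : T → ℝ) (hβ : Continuous β) (hβs : HasCompactSupport β)
    (χ : T → ℂ) (hχ : Continuous χ)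
    (Γ : Subgroup G) [Countable Γ] (𝓕 : Set G) (h𝓕 : IsFundamentalDomain Γ 𝓕 μ)
    (f : G → ℂ) (hf : Continuous f) (hfs : HasCompactSupport f)
    (v : G → ℂ) (hv : Continuous v) (hvinv : ∀ (γ : Γ) (y : G), v ((γ : G) * y) = v y) :
    ∫ y in 𝓕, Eis ν jT β χ Γ f y * (starRingEnd ℂ) (v y) ∂μ
      = ∫ h, f h * (starRingEnd ℂ) (∫ t, ((β t : ℂ) * (starRingEnd ℂ) (χ t)) * v (jT t * h) ∂ν) ∂μ := by
  have hK : Continuous fun y => (starRingEnd ℂ) (v y) := Complex.continuous_conj.comp hv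
  have hKinv : ∀ (γ : Γ) (y : G), (starRingEnd ℂ) (v ((γ : G) * y)) = (starRingEnd ℂ) (v y) := by
    intro γ y; rw [hvinv]
  have h := unfolding μ ν jT hjT β hβ hβs χ hχ Γ 𝓕 h𝓕 f hf hfs (fun y => (starRingEnd ℂ) (v y)) hK hKinv
  rw [h]
  congr 1
  ext h'
  congr 1
  rw [toricPeriod, ← integral_conj]
  congr 1
  ext t
  simp only [wt, map_mul, Complex.conj_ofReal, Complex.conj_conj]

end Unfolding

/-! ## The closed span of the pseudo-Eisenstein series is right-translation invariant -/

section SpanClosure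

variable {H : Type*} [AddCommGroup H] [Module ℂ H] [TopologicalSpace H] [IsTopologicalAddGroup H]
  [ContinuousSMul ℂ H]

/-- If a continuous linear operator `R` maps a set of vectors `S` into itself (as `R(h₀)` maps the
family of pseudo-Eisenstein series into itself by `Eis_rTrans`: `R(h₀)E^χ_f = E^χ_{f^{h₀}}`), then it
preserves the closure of the span of `S`. [folklore] -/
theorem closureSpan_invariant (R : H →L[ℂ] H) (S : Set H) (hS : Set.MapsTo R S S) :
    Set.MapsTo R ((Submodule.span ℂ S).topologicalClosure : Set H)
      ((Submodule.span ℂ S).topologicalClosure : Set H) := by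
  have hspan : Set.MapsTo R (Submodule.span ℂ S : Set H) (Submodule.span ℂ S : Set H) := by
    intro x hx
    have hle : Submodule.map (R : H →ₗ[ℂ] H) (Submodule.span ℂ S) ≤ Submodule.span ℂ S := by
      rw [Submodule.map_span]
      exact Submodule.span_mono hS.image_subset
    exact hle ⟨x, hx, rfl⟩
  intro x hx
  rw [Submodule.topologicalClosure_coe] at hx ⊢
  exact map_mem_closure R.continuous hx hspan

end SpanClosure

/-! ## The fundamental lemma and the annihilation consequence of `unfolding_inner`
(from `⟨E^χ_f, v⟩ = 0` for all `f ∈ C_c(G)`: the function `h ↦ P_{T,χ̄}(R(h)v)` is `≡ 0`) -/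

section FundamentalLemma

variable {G : Type*} [TopologicalSpace G] [T2Space G] [LocallyCompactSpace G]
  [MeasurableSpace G] [OpensMeasurableSpace G]

/-- **Fundamental lemma of the calculus of variations, continuous form.** If `φ` is continuous,
`μ` charges every non-empty open set (every Haar measure does) and `∫ f·φ dμ = 0` for every
continuous compactly supported `f`, then `φ = 0` — test against `f = ψ·φ̄` for a bump `ψ`.
[folklore] -/
theorem eq_zero_of_forall_integral_mul_eq_zero (μ : Measure G) [μ.IsOpenPosMeasure]
    [IsFiniteMeasureOnCompacts μ] (φ : G → ℂ) (hφ : Continuous φ)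
    (h : ∀ f : G → ℂ, Continuous f → HasCompactSupport f → ∫ x, f x * φ x ∂μ = 0) :
    φ = 0 := by
  funext x₀
  -- a bump `ψ ∈ C_c(G)`, `0 ≤ ψ ≤ 1`, `ψ x₀ = 1`
  obtain ⟨K, hK, hKx⟩ := exists_compact_mem_nhds x₀
  have hx₀ : x₀ ∈ interior K := mem_interior_iff_mem_nhds.2 hKx
  have hcl : IsCompact (closure (interior K)) :=
    hK.closure.of_isClosed_subset isClosed_closure (closure_mono interior_subset)
  obtain ⟨ψ, hψs, hψ1, hψ01⟩ := exists_tsupport_one_of_isOpen_isClosed isOpen_interior hcl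
    isClosed_singleton (Set.singleton_subset_iff.2 hx₀)
  have hψc : HasCompactSupport (ψ : G → ℝ) :=
    hcl.of_isClosed_subset (isClosed_tsupport _) (hψs.trans subset_closure)
  have hψx₀ : ψ x₀ = 1 := hψ1 (Set.mem_singleton x₀)
  -- the test function `f = ψ · conj φ`
  set f : G → ℂ := fun x => (ψ x : ℂ) * (starRingEnd ℂ) (φ x) with hf
  have hfc : Continuous f :=
    (Complex.continuous_ofReal.comp ψ.continuous).mul (Complex.continuous_conj.comp hφ)
  have hfs : HasCompactSupport f := by
    have h1 : HasCompactSupport fun x => (ψ x : ℂ) := hψc.comp_left Complex.ofReal_zero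
    exact h1.mul_right
  have h0 := h f hfc hfs
  have hreal : ∫ x, f x * φ x ∂μ = ((∫ x, ψ x * ‖φ x‖ ^ 2 ∂μ : ℝ) : ℂ) := by
    rw [← integral_complex_ofReal]
    congr 1
    ext x
    simp only [hf]
    rw [mul_assoc, Complex.conj_mul']
    push_cast
    ring
  rw [hreal] at h0
  have h0' : ∫ x, ψ x * ‖φ x‖ ^ 2 ∂μ = 0 := by exact_mod_cast h0
  have hgc : Continuous fun x => ψ x * ‖φ x‖ ^ 2 :=
    ψ.continuous.mul ((continuous_norm.comp hφ).pow 2)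
  have hgs : HasCompactSupport fun x => ψ x * ‖φ x‖ ^ 2 := hψc.mul_right
  have hgnn : 0 ≤ fun x => ψ x * ‖φ x‖ ^ 2 := fun x => mul_nonneg (hψ01 x).1 (sq_nonneg _)
  have hae := (integral_eq_zero_iff_of_nonneg hgnn (hgc.integrable_of_hasCompactSupport hgs)).1 h0'
  have heq : (fun x => ψ x * ‖φ x‖ ^ 2) = 0 :=
    (Continuous.ae_eq_iff_eq μ hgc continuous_zero).1 hae
  have hx := congr_fun heq x₀
  simp only [Pi.zero_apply, hψx₀, one_mul] at hx
  show φ x₀ = 0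
  exact norm_eq_zero.1 ((pow_eq_zero_iff two_ne_zero).1 hx)

end FundamentalLemma

section Consequence

variable {G : Type*} [Group G] [TopologicalSpace G] [IsTopologicalGroup G] [T2Space G]
  [LocallyCompactSpace G] [MeasurableSpace G] [BorelSpace G]
  {T : Type*} [Group T] [TopologicalSpace T] [T2Space T] [MeasurableSpace T] [OpensMeasurableSpace T]

omit [T2Space G] [LocallyCompactSpace G] [MeasurableSpace G] [BorelSpace G] [T2Space T] in
/-- Continuity of the truncated toric period `h ↦ ∫_T β(t) conj χ(t) v(jT(t) h) dν` of a continuous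
`v` (the function `h ↦ P_{T,χ̄}(R(h)v)`). [folklore] -/
theorem continuous_toricPeriod_conj (ν : Measure T) [IsFiniteMeasureOnCompacts ν]
    (jT : T →* G) (hjT : Continuous jT)
    (β : T → ℝ) (hβ : Continuous β) (hβs : HasCompactSupport β)
    (χ : T → ℂ) (hχ : Continuous χ) (v : G → ℂ) (hv : Continuous v) :
    Continuous fun h : G => ∫ t, ((β t : ℂ) * (starRingEnd ℂ) (χ t)) * v (jT t * h) ∂ν := by
  have hk : IsCompact (tsupport β) := hβs
  have hF : ContinuousOn (Function.uncurry
      fun (h : G) (t : T) => ((β t : ℂ) * (starRingEnd ℂ) (χ t)) * v (jT t * h)) (univ ×ˢ univ) := by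
    apply Continuous.continuousOn
    change Continuous fun p : G × T => ((β p.2 : ℂ) * (starRingEnd ℂ) (χ p.2)) * v (jT p.2 * p.1)
    exact (((Complex.continuous_ofReal.comp (hβ.comp continuous_snd)).mul
      (Complex.continuous_conj.comp (hχ.comp continuous_snd))).mul
      (hv.comp ((hjT.comp continuous_snd).mul continuous_fst)))
  have hzero : ∀ (p : G) (t : T), p ∈ (univ : Set G) → t ∉ tsupport β →
      (fun (h : G) (t : T) => ((β t : ℂ) * (starRingEnd ℂ) (χ t)) * v (jT t * h)) p t = 0 := by
    intro p t _ ht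
    simp only [image_eq_zero_of_notMem_tsupport ht, Complex.ofReal_zero, zero_mul]
  have h := continuousOn_integral_of_compact_support (μ := ν) hk hF hzero
  exact continuousOn_univ.mp h

/-- **Annihilation consequence.** If `v` (continuous, left-`Γ`-invariant — a vector of `L²(Γ\G)`
realised as a function) is orthogonal to every pseudo-Eisenstein series `E^χ_f`, `f ∈ C_c(G)`, then
the toric period of every right translate vanishes:
`P^β_{T,χ̄}(R(h)v) = ∫_T β conj χ · v(jT(·) h) dν = 0` for ALL `h ∈ G`
(`unfolding_inner` + the fundamental lemma `eq_zero_of_forall_integral_mul_eq_zero`; the toric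
analogue of "forms orthogonal to all pseudo-Eisenstein series have vanishing constant terms").
[cite: Garrett2018, §1.8 Cor. 1.8.2] -/
theorem toricPeriod_transl_eq_zero_of_orthogonal
    (μ : Measure G) [μ.IsMulLeftInvariant] [IsFiniteMeasureOnCompacts μ] [μ.IsOpenPosMeasure]
    (ν : Measure T) [IsFiniteMeasureOnCompacts ν]
    (jT : T →* G) (hjT : Continuous jT)
    (β : T → ℝ) (hβ : Continuous β) (hβs : HasCompactSupport β)
    (χ : T → ℂ) (hχ : Continuous χ)
    (Γ : Subgroup G) [Countable Γ] (𝓕 : Set G) (h𝓕 : IsFundamentalDomain Γ 𝓕 μ)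
    (v : G → ℂ) (hv : Continuous v) (hvinv : ∀ (γ : Γ) (y : G), v ((γ : G) * y) = v y)
    (horth : ∀ f : G → ℂ, Continuous f → HasCompactSupport f →
      ∫ y in 𝓕, Eis ν jT β χ Γ f y * (starRingEnd ℂ) (v y) ∂μ = 0)
    (h : G) :
    ∫ t, ((β t : ℂ) * (starRingEnd ℂ) (χ t)) * v (jT t * h) ∂ν = 0 := by
  set φ : G → ℂ := fun h => (starRingEnd ℂ) (∫ t, ((β t : ℂ) * (starRingEnd ℂ) (χ t)) * v (jT t * h) ∂ν)
    with hφdef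
  have hφ : Continuous φ :=
    Complex.continuous_conj.comp (continuous_toricPeriod_conj ν jT hjT β hβ hβs χ hχ v hv)
  have hzero : φ = 0 := by
    refine eq_zero_of_forall_integral_mul_eq_zero μ φ hφ ?_
    intro f hf hfs
    rw [← unfolding_inner μ ν jT hjT β hβ hβs χ hχ Γ 𝓕 h𝓕 f hf hfs v hv hvinv]
    exact horth f hf hfs
  have hh := congr_fun hzero h
  simpa [hφdef] using hh

end Consequence

end PseudoEisenstein

end Literature.NumberTheory.Automorphic

end
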